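/-
Copyright (c) 2026 the pub-hodgecm-mathlib formalisation cell (harness21).  R90-TF SLAB, section S6 «Ch14.1–5 stable TF» (Rogawski 1990, §4.9 Prop. 4.9.1 (b):
the spherical fundamental lemma, coefficient layer), prover K2E3-p17 (g12); WORK ORDER (R103) «G5 ELL-1», brick B-Σ of the internal road (R90 bus 2026-09-05T04:22:07Z);
h413 = `stmt-HodgeConjecture-24833`, route `HCCMUnconditional`.
-/
import Summits.HodgeConjecture.HodgeConjecture.Theorems.R90S6SatakeGraphPartnerOnBasisClosed   -- ★ H1 §3: `xiHCoeff`, `xiHCoeff_of_gt` (the table of `ξ̂_H(φ_m)`)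
import HarnessLib

/-!
# R90-TF ∕ S6 — G5 ELL cells, brick B-Σ: THE COEFFICIENT BOOKKEEPING of the spherical fundamental lemma — from the per-level count identities `(E)_m` and the
# partner table `ξ̂_H(φ_m) = Σ_{k≤m} c_{m,k} φ′_k` to the identity for an ARBITRARY Hecke element `φ = Σ_m a_m φ_m`
# (`Theorems/R90S6EllOneCoefficientSum.lean`; ns `Summit.HodgeConjecture.HodgeConjecture.R90.S6`; THEOREMS ONLY, frame-free finite-sum algebra over `ℂ`, 0 `sorry`)

THE ROAD (census `K2/K2E3-p17/g12/CENSUS-G5-EllOneCell-payer.md` d4404f24, link L6 ∕ step 4 of the assembly `R90S6HeckeFLAtFrameEllOneCell`).  At an inert unramified place the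
spherical Hecke algebra of `U(3)` has the Cartan basis `φ_m = 𝟙_{K̃ϖ^{(m,0,−m)}K̃}` (★ W8-a `R90S6CartanExhaustionU3`), that of `U(1,1)` the basis `φ′_k`, and ★ H1 §3
`R90S6SatakeGraphPartnerOnBasisClosed` gives print's `ξ̂_H` on the basis: `ξ̂_H(φ_m) = Σ_{k ≤ m} xiHCoeff q m k · φ′_k` (`xiHCoeff q m k = 0` for `k > m`, ★ `xiHCoeff_of_gt`).
The CELL PAYERS prove the transfer identity (4.9.1) one level `m` at a time, as a COUNT identity between the `G′_v`-side shell counts `S₃(tᵢ, m)` of the classes `tᵢ` of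
the norm class (weights `Δ‴ᵢ = Δ·κᵢ`) and the `H_v`-side shell counts `S₂(δⱼ, k)` of the classes of the stable class — for the type-(1) cell this is typ1's (E1)
«`Δ·(S₃(t₁,m)+S₃(t₂,m)−S₃(t₃,m)−S₃(t₄,m)) = Σ_{k≤m} xiHCoeff q m k·(S₂(δ₁,k)+S₂(δ₂,k))`» (★ (G1) 1a∕1b∕2∕3a∕3b modulo (U1)), for type (2) typ1's (E2)
(`kappaDiff`, one `H`-class).  THIS FILE is the pure bookkeeping turning «`(E)_m` for every `m`» into the identity for an arbitrary `φ = Σ_{m ≤ M} a_m φ_m` and its partner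
`ξ̂_H φ = Σ_{k ≤ M} (Σ_{m ≤ M} a_m · xiHCoeff q m k) φ′_k`: the `H`-side `Σ_k b_k · Σ_j S₂(δⱼ,k)` equals the `G`-side `Σ_i Δ‴ᵢ · Σ_m a_m S₃(tᵢ,m)` — a `Finset.sum_comm` over the
triangle `k ≤ m ≤ M`, rectangularised by `xiHCoeff_of_gt`.  Stated for ANY number of `G`-classes `n`, `H`-classes `r` and any sign∕weight vector `κ`, so the ELL-1 payer
(`n = 4`, `r = 2`, `κ = (+,+,−,−)`) and the ELL-2 payer (`n = 2`, `r = 1`, `κ = (+,−)`, K2Liu-p05) both import it.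
* `sum_xiHCoeff_range_eq_sum_range_succ` — rectangularisation: `Σ_{k ≤ M} xiHCoeff q m k · T k = Σ_{k ≤ m} xiHCoeff q m k · T k` for `m ≤ M`;
* `partnerCoeff_sum_eq_sum_levels` (abstract collection `Σ_k b_k T k = Σ_m a_m G m`), `sum_weight_sum_eq_sum_levels` (the `G`-side rearrangement);
* `partnerCoeff_sum_eq_sum_weight_sum` — THE HEAD: `Σ_{k≤M} (Σ_{m≤M} a_m·xiHCoeff q m k)·(Σ_j S₂ j k) = Σ_i (Δ·κ_i)·(Σ_{m≤M} a_m·S₃ i m)` from `hE : ∀ m, Δ·Σ_i κ_i·S₃ i m = Σ_{k≤m} xiHCoeff q m k·Σ_j S₂ j k`;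
* `partnerCoeff_sum_eq_sum_weight_sum_of_le` — the same with `(E)_m` assumed only for `m ≤ M`; §3 the two cells' weight vectors (`sum_kappa_typeOne`: `κ = (+,+,−,−)`;
  `sum_kappa_typeTwo`: `κ = (+,−)`).
HONEST LABEL: count-neutral algebra; pays no socket by itself; HC_CM is proved only modulo the 7 printed citations (2 remaining named inputs: hLiu418 = `stmt-HodgeConjecture-24832`,
h413 = `stmt-HodgeConjecture-24833`) until rung 0 closes; REL ≠ ★ ≠ BUILT.

## References
* [Rogawski1990] J. D. Rogawski, *Automorphic Representations of Unitary Groups in Three Variables*, Ann. of Math. Stud. 123 (1990): §4.9 Prop. 4.9.1 (b) p. 55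
  (`ξ̂_H(f)^∧(z) = f^∧(−z)`, the fundamental lemma for the spherical Hecke algebra); §4.3 (4.3.1) p. 43.
* [Macdonald1971] I. G. Macdonald, *Spherical Functions on a Group of p-adic Type* (1971), Ch. V §3 (the rank-one spherical basis and its Satake coefficients).
-/

set_option autoImplicit false
-- the mandated namespace repeats `HodgeConjecture.HodgeConjecture`, as in every `Theorems/*.lean` of this sub-problem
set_option linter.dupNamespace false

noncomputable section

open Finset

namespace Summit.HodgeConjecture.HodgeConjecture.R90.S6

/-! ## §1 Rectangularisation of the triangular partner table -/

/-- **Rectangularisation**: for `m ≤ M`, `Σ_{k ≤ M} xiHCoeff q m k · T k = Σ_{k ≤ m} xiHCoeff q m k · T k` (the table vanishes above the diagonal, ★ `xiHCoeff_of_gt`).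
[cite: Rogawski1990, §4.9 Prop. 4.9.1 (b) p. 55] [cite: Macdonald1971, Ch. V §3] -/
theorem sum_xiHCoeff_range_eq_sum_range_succ (q : ℕ) {m M : ℕ} (hm : m ≤ M) (T : ℕ → ℂ) :
    ∑ k ∈ range (M + 1), xiHCoeff q m k * T k = ∑ k ∈ range (m + 1), xiHCoeff q m k * T k := by
  symm
  refine sum_subset (fun k hk => ?_) (fun k _ hk => ?_)
  · exact mem_range.2 (lt_of_lt_of_le (mem_range.1 hk) (Nat.succ_le_succ hm))
  · rw [xiHCoeff_of_gt (by have := mem_range.not.1 hk; omega), zero_mul]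

/-! ## §2 THE HEAD: the partner-coefficient sum on the `H`-side equals the weighted coefficient sum on the `G`-side -/

/-- **Level-by-level collection (abstract form)**: if `G m = Σ_{k ≤ m} xiHCoeff q m k · T k` for every `m ≤ M`, then for every coefficient vector `a`,
`Σ_{k ≤ M} (Σ_{m ≤ M} a_m · xiHCoeff q m k) · T k = Σ_{m ≤ M} a_m · G m` (swap the sums over the rectangle `k, m ≤ M`, then cut back to the triangle `k ≤ m`).
[cite: Rogawski1990, §4.9 Prop. 4.9.1 (b) p. 55] [cite: Macdonald1971, Ch. V §3] -/
theorem partnerCoeff_sum_eq_sum_levels (q M : ℕ) (a T G : ℕ → ℂ) (hE : ∀ m, m ≤ M → G m = ∑ k ∈ range (m + 1), xiHCoeff q m k * T k) :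
    ∑ k ∈ range (M + 1), (∑ m ∈ range (M + 1), a m * xiHCoeff q m k) * T k = ∑ m ∈ range (M + 1), a m * G m := by
  calc ∑ k ∈ range (M + 1), (∑ m ∈ range (M + 1), a m * xiHCoeff q m k) * T k
      = ∑ k ∈ range (M + 1), ∑ m ∈ range (M + 1), a m * xiHCoeff q m k * T k := sum_congr rfl fun k _ => sum_mul _ _ _
    _ = ∑ m ∈ range (M + 1), ∑ k ∈ range (M + 1), a m * xiHCoeff q m k * T k := sum_comm
    _ = ∑ m ∈ range (M + 1), a m * ∑ k ∈ range (M + 1), xiHCoeff q m k * T k :=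
        sum_congr rfl fun m _ => by rw [mul_sum]; exact sum_congr rfl fun k _ => mul_assoc _ _ _
    _ = ∑ m ∈ range (M + 1), a m * G m :=
        sum_congr rfl fun m hm => by
          have hmM : m ≤ M := Nat.lt_succ_iff.1 (mem_range.1 hm)
          rw [sum_xiHCoeff_range_eq_sum_range_succ q hmM T, hE m hmM]

/-- **Weighted collection on the `G`-side**: `Σ_i (Δ κ_i) · Σ_{m ≤ M} a_m S₃ i m = Σ_{m ≤ M} a_m · (Δ · Σ_i κ_i S₃ i m)`. [cite: Rogawski1990, §4.3 (4.3.1) p. 43] -/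
theorem sum_weight_sum_eq_sum_levels (M : ℕ) (Δ : ℂ) {n : ℕ} (κ : Fin n → ℂ) (S₃ : Fin n → ℕ → ℂ) (a : ℕ → ℂ) :
    ∑ i, (Δ * κ i) * ∑ m ∈ range (M + 1), a m * S₃ i m = ∑ m ∈ range (M + 1), a m * (Δ * ∑ i, κ i * S₃ i m) := by
  calc ∑ i, (Δ * κ i) * ∑ m ∈ range (M + 1), a m * S₃ i m
      = ∑ i, ∑ m ∈ range (M + 1), (Δ * κ i) * (a m * S₃ i m) := Finset.sum_congr rfl fun i _ => mul_sum _ _ _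
    _ = ∑ m ∈ range (M + 1), ∑ i, (Δ * κ i) * (a m * S₃ i m) := sum_comm
    _ = ∑ m ∈ range (M + 1), a m * (Δ * ∑ i, κ i * S₃ i m) :=
        sum_congr rfl fun m _ => by rw [mul_sum, mul_sum]; exact Finset.sum_congr rfl fun i _ => by ring

/-- **B-Σ, THE HEAD — «`(E)_m` for every `m`» ⇒ the transfer identity for every `φ = Σ_{m ≤ M} a_m φ_m`.**  Given `G`-side shell counts `S₃ : Fin n → ℕ → ℂ` with weights
`κ : Fin n → ℂ` and a common factor `Δ` (the transfer factor `Δ‴ᵢ = Δ·κᵢ` on the `n` classes of the norm class), `H`-side shell counts `S₂ : Fin r → ℕ → ℂ` on the `r` classes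
of the stable class, and the per-level identities `(E)_m`: `Δ·Σ_i κ_i S₃ i m = Σ_{k ≤ m} xiHCoeff q m k · Σ_j S₂ j k`, the coefficients `a : ℕ → ℂ` of `φ` and the partner
coefficients `b_k := Σ_{m ≤ M} a_m · xiHCoeff q m k` of `ξ̂_H φ` satisfy `Σ_{k ≤ M} b_k · Σ_j S₂ j k = Σ_i (Δ·κ_i) · Σ_{m ≤ M} a_m · S₃ i m`.
[cite: Rogawski1990, §4.9 Prop. 4.9.1 (b) p. 55; §4.3 (4.3.1) p. 43] [cite: Macdonald1971, Ch. V §3] -/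
theorem partnerCoeff_sum_eq_sum_weight_sum (q M : ℕ) (Δ : ℂ) {n r : ℕ} (κ : Fin n → ℂ) (S₃ : Fin n → ℕ → ℂ) (S₂ : Fin r → ℕ → ℂ) (a : ℕ → ℂ)
    (hE : ∀ m, Δ * ∑ i, κ i * S₃ i m = ∑ k ∈ range (m + 1), xiHCoeff q m k * ∑ j, S₂ j k) :
    ∑ k ∈ range (M + 1), (∑ m ∈ range (M + 1), a m * xiHCoeff q m k) * ∑ j, S₂ j k =
      ∑ i, (Δ * κ i) * ∑ m ∈ range (M + 1), a m * S₃ i m := by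
  rw [sum_weight_sum_eq_sum_levels M Δ κ S₃ a]
  exact partnerCoeff_sum_eq_sum_levels q M a (fun k => ∑ j, S₂ j k) (fun m => Δ * ∑ i, κ i * S₃ i m) fun m _ => hE m

/-- **B-Σ with `(E)_m` assumed only up to the depth of `φ`** (`m ≤ M`). [cite: Rogawski1990, §4.9 Prop. 4.9.1 (b) p. 55; §4.3 (4.3.1) p. 43] -/
theorem partnerCoeff_sum_eq_sum_weight_sum_of_le (q M : ℕ) (Δ : ℂ) {n r : ℕ} (κ : Fin n → ℂ) (S₃ : Fin n → ℕ → ℂ) (S₂ : Fin r → ℕ → ℂ) (a : ℕ → ℂ)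
    (hE : ∀ m, m ≤ M → Δ * ∑ i, κ i * S₃ i m = ∑ k ∈ range (m + 1), xiHCoeff q m k * ∑ j, S₂ j k) :
    ∑ k ∈ range (M + 1), (∑ m ∈ range (M + 1), a m * xiHCoeff q m k) * ∑ j, S₂ j k =
      ∑ i, (Δ * κ i) * ∑ m ∈ range (M + 1), a m * S₃ i m := by
  rw [sum_weight_sum_eq_sum_levels M Δ κ S₃ a]
  exact partnerCoeff_sum_eq_sum_levels q M a (fun k => ∑ j, S₂ j k) (fun m => Δ * ∑ i, κ i * S₃ i m) hE

/-! ## §3 The two cells' instances of the weight vector -/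

/-- **Type-(1) cell (ELL-1)**: `n = 4`, `κ = (+1, +1, −1, −1)` — the weighted `G`-side sum is `Δ·(S₃ t₁ + S₃ t₂ − S₃ t₃ − S₃ t₄)` (typ1 (E1)'s `kappaSum` shape).
[cite: Rogawski1990, §4.9 Prop. 4.9.1 (b) p. 55] [cite: Flicker1998UnitaryFL, §6 p. 95] -/
theorem sum_kappa_typeOne (Δ : ℂ) (S : Fin 4 → ℂ) :
    ∑ i, (Δ * (![1, 1, -1, -1] : Fin 4 → ℂ) i) * S i = Δ * (S 0 + S 1 - S 2 - S 3) := by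
  simp [Fin.sum_univ_four]
  ring

/-- **Type-(2) cell (ELL-2)**: `n = 2`, `κ = (+1, −1)` — the weighted `G`-side sum is `Δ·(S₃ t₁′ − S₃ t₂′)` (typ1 (E2)'s `kappaDiff` shape).
[cite: Rogawski1990, §4.9 Prop. 4.9.1 (b) p. 55] [cite: Flicker1998UnitaryFL, §6 p. 95] -/
theorem sum_kappa_typeTwo (Δ : ℂ) (S : Fin 2 → ℂ) :
    ∑ i, (Δ * (![1, -1] : Fin 2 → ℂ) i) * S i = Δ * (S 0 - S 1) := by
  simp [Fin.sum_univ_two]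
  ring

end Summit.HodgeConjecture.HodgeConjecture.R90.S6

end
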